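import Summits.CriticalPhenomena.PercolationContinuityZ3.Theorems.PercSupergraphDichotomyCCDGraphZ3
import HarnessLib

/-!
# `PercSupergraphDichotomy.SupergraphContinuity` (stmt-CriticalPhenomena-11898) is FALSE

builds on p205010 (kernel theorem, internal audit signed; external expert review pending) — NOT used in this file.
RSW3 lane (cell `prim-rsw3`, prover P2, gen 37).  REFUTES the thesis `X = SupergraphContinuity` of route
`CriticalPhenomena/PercSupergraphDichotomy` ("every simple graph `G` with `ℤ³ ≤ G ≤` the unit-cube graph and `p_c(G) = p_c(ℤ³)` has
`θ_G(0; p_c(ℤ³)) = 0`"): the Chayes–Chayes–Durrett graph of `CCDShell.ccdGraphZ3_proof` (`…CCDGraphZ3.lean`) is such a `G` with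
`θ_G(0; p_c(ℤ³)) > 0`.  (The route itself records `CCDGraphZ3 ↔ ¬ SupergraphContinuity` as `DichotomyLink`; the five-line proof is repeated
here to keep this file's imports free of the continuity theorem.)  Classification: refuted-substantive — the load-bearing claim is false
as stated; the planner's own route docstring expected this ("Expected FALSE: CCDGraphZ3 is exactly ¬X").  Continuity of `θ_{ℤ³}` at
`p_c(ℤ³)` (the conjunct `PercolationContinuityZ3`, `G = ℤ³`) is untouched: the counterexample is a strict supergraph.

Reference: J. T. Chayes, L. Chayes, R. Durrett, J. Phys. A 20 (1987) 1521–1530 [ChayesChayesDurrett1987].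
-/

namespace Summit.CriticalPhenomena.PercolationContinuityZ3.Theorems.CCDShell

/-- **refuted-substantive: `SupergraphContinuity` is FALSE** — witness: the Chayes–Chayes–Durrett graph
`G = ℤ³ ⊔ ⋃_j (E(D_{2^{k(j)}}) ∩ B(0, 3·2^j)⁽²⁾)` of `ccdGraphZ3_proof`, a unit-cube supergraph of `ℤ³` with `p_c(G) = p_c(ℤ³)` and
`θ_G(0; p_c(ℤ³)) > 0`; no cheap repair: the statement quantifies over ALL unit-cube supergraphs with the same `p_c`, and the
counterexample is exactly the mechanism the route was built to test (inhomogeneous enhancement rarefying at infinity).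
[cite: ChayesChayesDurrett1987, §1 Thm 1] -/
theorem not_SupergraphContinuity :
    ¬ Summit.CriticalPhenomena.PercolationContinuityZ3.Theses.PercSupergraphDichotomy.SupergraphContinuity := by
  intro hX
  obtain ⟨G, hzd, hrange, hpc, hθ⟩ := ccdGraphZ3_proof
  have := hX G hzd hrange hpc
  rw [this] at hθ
  exact lt_irrefl _ hθ

end Summit.CriticalPhenomena.PercolationContinuityZ3.Theorems.CCDShell
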